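import Mathlib

/-!
# ω-census (abelian STPP census): Hamidoune–Rødseth for three-element sets — the two-run shift lemma (pure arithmetic)

HONEST FRAMING (pub-omega census; verbatim): lottery ticket; floor = certified bounds/negative ranges.
Census STRUCTURE / KERNEL desk (seat pub-omega-stpp-2 gen 24, 2026-08-28), family (b2).  This file is the arithmetic core of an
UNCONDITIONAL proof of `HamidouneRodsethCard 3` (`STPPVosperSlackOneLawCard.lean`: the Hamidoune–Rødseth inverse theorem mod `p` for
`|S| = 3`), which the slack-1 Vosper kills of the `ℤ₆₁` / `ℤ₅₉` fronts take as a hypothesis.  Nothing here is progress on `ω`.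

## What is here

A set `T ⊆ ℤ/pℤ` with exactly two maximal runs along `+1` is, after a translation, the set of residues whose value lies in
`[0, ℓ₁) ∪ [ℓ₁+g₁, ℓ₁+g₁+ℓ₂)` (`ℓ₁, ℓ₂ ≥ 1` run lengths, `g₁, g₂ ≥ 1` gaps, `ℓ₁+g₁+ℓ₂+g₂ = p`); `U = T ∪ (T+1)` is then `[0, ℓ₁] ∪ [ℓ₁+g₁, ℓ₁+g₁+ℓ₂]`.
For a shift `v` (`2 ≤ v < p`) call `n ∈ T` BAD when `n + v (mod p) ∉ U`.  `two_run_families`: if `ℓ₁+ℓ₂ ≥ 4`, `g₁+g₂ ≥ 7` and there is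
EXACTLY ONE bad `n` (this is what `|{0,1,v} + T| = |T| + 3` says), then the parameters belong to one of twelve explicit families (`Fam`):
eight with a gap of size `1` and `v ∈ {2, 3, p−2, p−1}` (difference `1` in the inverse theorem) and four 'antipodal' ones
(`v + 1 = ℓ₁+g₁`, `v + ℓ₁+g₁+1 = p`, `v = ℓ₁+g₂+2`, `v = ℓ₂+g₁+2` with the runs and gaps balanced to within `2`; difference `(p+1)/2`).
`two_run_shape`: for odd `p` the families give the index bounds used to exhibit the progressions.  Everything is `omega` after an
explicit case tree; the statement was checked exhaustively for all parameters with `p ≤ 30` before typing (seat script nat_lemma_check.py).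

References (for the theorem this serves): Y. O. Hamidoune, Ø. J. Rødseth, *An inverse theorem mod p*, Acta Arith. 92 (2000) 251–262;
O. Serra, G. Zémor, Integers 0 (2000) A10, Theorem 3.
-/

namespace Summit.MatrixMultiplication.OmegaCensus.HR3

/-- Value-membership in the two-run pattern `[0, ℓ₁) ∪ [ℓ₁+g₁, ℓ₁+g₁+ℓ₂)`. [folklore] -/
def InT (ℓ₁ g₁ ℓ₂ n : ℕ) : Prop := n < ℓ₁ ∨ (ℓ₁ + g₁ ≤ n ∧ n < ℓ₁ + g₁ + ℓ₂)

/-- Value-membership in `U = T ∪ (T+1)`: `[0, ℓ₁] ∪ [ℓ₁+g₁, ℓ₁+g₁+ℓ₂]`. [folklore] -/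
def InU (ℓ₁ g₁ ℓ₂ n : ℕ) : Prop := n ≤ ℓ₁ ∨ (ℓ₁ + g₁ ≤ n ∧ n ≤ ℓ₁ + g₁ + ℓ₂)

/-- Reduction of `m < 2p` modulo `p`. [folklore] -/
def wrap (p m : ℕ) : ℕ := if m < p then m else m - p

/-- `n` is BAD for the shift `v`: `n + v (mod p)` is not in `U`. [folklore] -/
def Bad (p ℓ₁ g₁ ℓ₂ v n : ℕ) : Prop := ¬ InU ℓ₁ g₁ ℓ₂ (wrap p (n + v))

/-- The twelve families of two-run configurations with exactly one bad point (see the module docstring). [folklore] -/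
def Fam (p ℓ₁ g₁ ℓ₂ g₂ v : ℕ) : Prop :=
  (g₁ = 1 ∧ (v = 2 ∨ (v = 3 ∧ ℓ₂ = 1) ∨ v + 1 = p ∨ (v + 2 = p ∧ ℓ₁ = 1))) ∨
  (g₂ = 1 ∧ (v = 2 ∨ (v = 3 ∧ ℓ₁ = 1) ∨ v + 1 = p ∨ (v + 2 = p ∧ ℓ₂ = 1))) ∨
  (v + 1 = ℓ₁ + g₁ ∧ 2 ≤ ℓ₁ ∧ ℓ₁ ≤ ℓ₂ + 2 ∧ g₁ ≤ g₂ + 2 ∧ ℓ₂ + g₂ + 1 ≤ ℓ₁ + g₁) ∨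
  (v + ℓ₁ + g₁ + 1 = p ∧ 2 ≤ ℓ₂ ∧ ℓ₂ ≤ ℓ₁ + 2 ∧ g₂ ≤ g₁ + 2 ∧ ℓ₁ + g₁ + 1 ≤ ℓ₂ + g₂) ∨
  (v = ℓ₁ + g₂ + 2 ∧ ℓ₂ ≤ ℓ₁ + 2 ∧ g₁ ≤ g₂ + 2 ∧ ℓ₁ + g₂ + 1 ≤ ℓ₂ + g₁) ∨
  (v = ℓ₂ + g₁ + 2 ∧ 2 ≤ ℓ₁ ∧ ℓ₁ ≤ ℓ₂ + 2 ∧ g₂ ≤ g₁ + 2 ∧ ℓ₂ + g₁ + 1 ≤ ℓ₁ + g₂)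

section Main

variable {p ℓ₁ g₁ ℓ₂ g₂ v : ℕ}

/-- The standing hypotheses of the two-run shift lemma, bundled. [folklore] -/
structure Hyp (p ℓ₁ g₁ ℓ₂ g₂ v : ℕ) : Prop where
  hℓ₁ : 1 ≤ ℓ₁
  hℓ₂ : 1 ≤ ℓ₂
  hg₁ : 1 ≤ g₁
  hg₂ : 1 ≤ g₂
  hp : ℓ₁ + g₁ + ℓ₂ + g₂ = p
  hL : 4 ≤ ℓ₁ + ℓ₂
  hg : 7 ≤ g₁ + g₂
  hv2 : 2 ≤ v
  hvp : v < p
  hAMO : ∀ n n', InT ℓ₁ g₁ ℓ₂ n → InT ℓ₁ g₁ ℓ₂ n' → Bad p ℓ₁ g₁ ℓ₂ v n → Bad p ℓ₁ g₁ ℓ₂ v n' → n = n'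
  hEX : ∃ n, InT ℓ₁ g₁ ℓ₂ n ∧ Bad p ℓ₁ g₁ ℓ₂ v n

/-- Region 1: `v ≤ ℓ₁`. [folklore] -/
theorem fam_R1 (H : Hyp p ℓ₁ g₁ ℓ₂ g₂ v) (hR1 : v ≤ ℓ₁) : Fam p ℓ₁ g₁ ℓ₂ g₂ v := by
  obtain ⟨hℓ₁, hℓ₂, hg₁, hg₂, hp, hL, hg, hv2, hvp, hAMO, -⟩ := H
  have two : ∀ n n', n ≠ n' → InT ℓ₁ g₁ ℓ₂ n → InT ℓ₁ g₁ ℓ₂ n' → Bad p ℓ₁ g₁ ℓ₂ v n → Bad p ℓ₁ g₁ ℓ₂ v n' →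
      Fam p ℓ₁ g₁ ℓ₂ g₂ v := fun n n' hne h1 h2 h3 h4 => absurd (hAMO n n' h1 h2 h3 h4) hne
  by_cases hg1 : g₁ = 1
  · by_cases hv3 : v ≤ 3
    · by_cases hv : v = 2
      · exact Or.inl ⟨by omega, by omega⟩
      · -- v = 3
        by_cases hl2 : ℓ₂ = 1
        · exact Or.inl ⟨by omega, by omega⟩
        · refine two (ℓ₁ + ℓ₂ - 1) (ℓ₁ + ℓ₂) (by omega) (by unfold InT; omega) (by unfold InT; omega) ?_ ?_ <;>
            · simp only [Bad, InU, wrap]; split_ifs <;> omega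
    · by_cases hvg : v ≤ g₂
      · by_cases hl2 : ℓ₂ = 1
        · refine two (ℓ₁ + ℓ₂) (ℓ₁ + ℓ₂ - 2) (by omega) (by unfold InT; omega) (by unfold InT; omega) ?_ ?_ <;>
            · simp only [Bad, InU, wrap]; split_ifs <;> omega
        · refine two (ℓ₁ + ℓ₂) (ℓ₁ + ℓ₂ - 1) (by omega) (by unfold InT; omega) (by unfold InT; omega) ?_ ?_ <;>
            · simp only [Bad, InU, wrap]; split_ifs <;> omega
      · -- v > g₂: among p-1-v, p-2-v, p-3-v (all in [0, L-1]) two avoid the hole ℓ₁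
        by_cases ha : p - 1 - v = ℓ₁
        · refine two (p - 2 - v) (p - 3 - v) (by omega) (by unfold InT; omega) (by unfold InT; omega) ?_ ?_ <;>
            · simp only [Bad, InU, wrap]; split_ifs <;> omega
        · by_cases hb : p - 2 - v = ℓ₁
          · refine two (p - 1 - v) (p - 3 - v) (by omega) (by unfold InT; omega) (by unfold InT; omega) ?_ ?_ <;>
              · simp only [Bad, InU, wrap]; split_ifs <;> omega
          · refine two (p - 1 - v) (p - 2 - v) (by omega) (by unfold InT; omega) (by unfold InT; omega) ?_ ?_ <;>
              · simp only [Bad, InU, wrap]; split_ifs <;> omega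
  · -- g₁ ≥ 2: the point ℓ₁ + 1 - v is bad
    by_cases hA : 3 ≤ v ∧ 3 ≤ g₁
    · refine two (ℓ₁ + 1 - v) (ℓ₁ + 2 - v) (by omega) (by unfold InT; omega) (by unfold InT; omega) ?_ ?_ <;>
        · simp only [Bad, InU, wrap]; split_ifs <;> omega
    · by_cases hv : v = 2
      · by_cases hg2 : g₂ = 1
        · exact Or.inr (Or.inl ⟨by omega, by omega⟩)
        · refine two (ℓ₁ - 1) (ℓ₁ + g₁ + ℓ₂ - 1) (by omega) (by unfold InT; omega) (by unfold InT; omega) ?_ ?_ <;>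
            · simp only [Bad, InU, wrap]; split_ifs <;> omega
      · -- v ≥ 3 and g₁ = 2
        by_cases hvl : ℓ₂ + 4 ≤ v
        · refine two (ℓ₁ + 1 - v) (ℓ₁ + ℓ₂ + 3 - v) (by omega) (by unfold InT; omega) (by unfold InT; omega) ?_ ?_ <;>
            · simp only [Bad, InU, wrap]; split_ifs <;> omega
        · by_cases hvl' : v ≤ ℓ₂
          · refine two (ℓ₁ + 1 - v) (ℓ₁ + g₁ + ℓ₂ + 1 - v) (by omega) (by unfold InT; omega) (by unfold InT; omega)
              ?_ ?_ <;>
              · simp only [Bad, InU, wrap]; split_ifs <;> omega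
          · refine two (ℓ₁ + 1 - v) (ℓ₁ + g₁) (by omega) (by unfold InT; omega) (by unfold InT; omega) ?_ ?_ <;>
              · simp only [Bad, InU, wrap]; split_ifs <;> omega

/-- Region 2: `v` in the first gap. [folklore] -/
theorem fam_R2 (H : Hyp p ℓ₁ g₁ ℓ₂ g₂ v) (hR1 : ℓ₁ < v) (hR2 : v < ℓ₁ + g₁) : Fam p ℓ₁ g₁ ℓ₂ g₂ v := by
  obtain ⟨hℓ₁, hℓ₂, hg₁, hg₂, hp, hL, hg, hv2, hvp, hAMO, -⟩ := H
  have two : ∀ n n', n ≠ n' → InT ℓ₁ g₁ ℓ₂ n → InT ℓ₁ g₁ ℓ₂ n' → Bad p ℓ₁ g₁ ℓ₂ v n → Bad p ℓ₁ g₁ ℓ₂ v n' →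
      Fam p ℓ₁ g₁ ℓ₂ g₂ v := fun n n' hne h1 h2 h3 h4 => absurd (hAMO n n' h1 h2 h3 h4) hne
  by_cases hl1 : 2 ≤ ℓ₁
  · by_cases hvA : v + 1 < ℓ₁ + g₁
    · refine two 0 1 (by omega) (by unfold InT; omega) (by unfold InT; omega) ?_ ?_ <;>
        · simp only [Bad, InU, wrap]; split_ifs <;> omega
    · -- v + 1 = ℓ₁ + g₁
      by_cases hl12 : ℓ₂ + 3 ≤ ℓ₁
      · by_cases hg2 : g₂ = 1
        · refine two 0 (ℓ₁ + g₁ + ℓ₂ - 1) (by omega) (by unfold InT; omega) (by unfold InT; omega) ?_ ?_ <;>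
            · simp only [Bad, InU, wrap]; split_ifs <;> omega
        · refine two 0 (ℓ₂ + 2) (by omega) (by unfold InT; omega) (by unfold InT; omega) ?_ ?_ <;>
            · simp only [Bad, InU, wrap]; split_ifs <;> omega
      · by_cases hAl : ℓ₁ + g₁ ≤ ℓ₂ + 1
        · by_cases hg2 : g₂ = 1
          · refine two 0 (ℓ₁ + ℓ₂ + 3) (by omega) (by unfold InT; omega) (by unfold InT; omega) ?_ ?_ <;>
              · simp only [Bad, InU, wrap]; split_ifs <;> omega
          · refine two 0 (ℓ₂ + 2) (by omega) (by unfold InT; omega) (by unfold InT; omega) ?_ ?_ <;>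
              · simp only [Bad, InU, wrap]; split_ifs <;> omega
        · by_cases hAl' : ℓ₁ + g₁ ≤ ℓ₂ + g₂
          · refine two 0 (ℓ₁ + g₁) (by omega) (by unfold InT; omega) (by unfold InT; omega) ?_ ?_ <;>
              · simp only [Bad, InU, wrap]; split_ifs <;> omega
          · by_cases hgg : g₂ + 3 ≤ g₁
            · refine two 0 (ℓ₁ + g₁ + ℓ₂ - 1) (by omega) (by unfold InT; omega) (by unfold InT; omega) ?_ ?_ <;>
                · simp only [Bad, InU, wrap]; split_ifs <;> omega
            · exact Or.inr (Or.inr (Or.inl ⟨by omega, by omega, by omega, by omega, by omega⟩))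
  · -- ℓ₁ = 1
    by_cases hvl : v ≤ ℓ₂
    · by_cases hg2 : g₂ = 1
      · by_cases hv4 : 4 ≤ v
        · refine two 0 (2 + p - v) (by omega) (by unfold InT; omega) (by unfold InT; omega) ?_ ?_ <;>
            · simp only [Bad, InU, wrap]; split_ifs <;> omega
        · exact Or.inr (Or.inl ⟨by omega, by omega⟩)
      · refine two 0 (ℓ₁ + g₁ + ℓ₂ + 1 - v) (by omega) (by unfold InT; omega) (by unfold InT; omega) ?_ ?_ <;>
          · simp only [Bad, InU, wrap]; split_ifs <;> omega
    · by_cases hAv : ℓ₁ + g₁ + v + 1 ≤ p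
      · refine two 0 (ℓ₁ + g₁) (by omega) (by unfold InT; omega) (by unfold InT; omega) ?_ ?_ <;>
          · simp only [Bad, InU, wrap]; split_ifs <;> omega
      · refine two 0 (ℓ₁ + g₁ + ℓ₂ - 1) (by omega) (by unfold InT; omega) (by unfold InT; omega) ?_ ?_ <;>
          · simp only [Bad, InU, wrap]; split_ifs <;> omega

/-- Region 3a: `v` in the second block of `U`, the first run fits. [folklore] -/
theorem fam_R3a (H : Hyp p ℓ₁ g₁ ℓ₂ g₂ v) (hR2 : ℓ₁ + g₁ ≤ v) (hR3 : v ≤ ℓ₁ + g₁ + ℓ₂)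
    (hfit : v + ℓ₁ ≤ ℓ₁ + g₁ + ℓ₂ + 1) : Fam p ℓ₁ g₁ ℓ₂ g₂ v := by
  obtain ⟨hℓ₁, hℓ₂, hg₁, hg₂, hp, hL, hg, hv2, hvp, hAMO, hEX⟩ := H
  have two : ∀ n n', n ≠ n' → InT ℓ₁ g₁ ℓ₂ n → InT ℓ₁ g₁ ℓ₂ n' → Bad p ℓ₁ g₁ ℓ₂ v n → Bad p ℓ₁ g₁ ℓ₂ v n' →
      Fam p ℓ₁ g₁ ℓ₂ g₂ v := fun n n' hne h1 h2 h3 h4 => absurd (hAMO n n' h1 h2 h3 h4) hne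
  obtain ⟨n₀, hn₀T, hn₀B⟩ := hEX
  simp only [InT] at hn₀T
  simp only [Bad, InU, wrap] at hn₀B
  by_cases hvl : v ≤ ℓ₂
  · by_cases hv : v = 2
    · exact Or.inl ⟨by omega, by omega⟩
    · by_cases hg2 : 3 ≤ g₂
      · refine two (ℓ₁ + g₁ + ℓ₂ + 1 - v) (ℓ₁ + g₁ + ℓ₂ + 2 - v) (by omega) (by unfold InT; omega)
          (by unfold InT; omega) ?_ ?_ <;>
          · simp only [Bad, InU, wrap]; split_ifs <;> omega
      · by_cases hg2' : g₂ = 2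
        · refine two (ℓ₁ + g₁ + ℓ₂ + 1 - v) (ℓ₁ + 1 + p - v) (by omega) (by unfold InT; omega)
            (by unfold InT; omega) ?_ ?_ <;>
            · simp only [Bad, InU, wrap]; split_ifs <;> omega
        · refine two (ℓ₁ + 1 + p - v) (ℓ₁ + 2 + p - v) (by omega) (by unfold InT; omega)
            (by unfold InT; omega) ?_ ?_ <;>
            · simp only [Bad, InU, wrap]; split_ifs <;> omega
  · by_cases hAv : ℓ₁ + g₁ + v + 1 ≤ p
    · by_cases hl2 : ℓ₂ = 1
      · exfalso; omega
      · by_cases hAv' : ℓ₁ + g₁ + v + 2 ≤ p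
        · refine two (ℓ₁ + g₁) (ℓ₁ + g₁ + 1) (by omega) (by unfold InT; omega) (by unfold InT; omega) ?_ ?_ <;>
            · simp only [Bad, InU, wrap]; split_ifs <;> omega
        · -- ℓ₁ + g₁ + v + 1 = p
          by_cases hl12 : ℓ₁ + 3 ≤ ℓ₂
          · by_cases hg1 : g₁ = 1
            · exfalso; omega
            · refine two (ℓ₁ + g₁) (2 * ℓ₁ + g₁ + 2) (by omega) (by unfold InT; omega) (by unfold InT; omega)
                ?_ ?_ <;>
                · simp only [Bad, InU, wrap]; split_ifs <;> omega
          · exact Or.inr (Or.inr (Or.inr (Or.inl ⟨by omega, by omega, by omega, by omega, by omega⟩)))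
    · -- ℓ₁ + g₁ + v ≥ p: the image of the second run is wrapped, c = ℓ₁ + g₁ + v - p
      by_cases hc1 : ℓ₁ + g₁ + v + ℓ₂ ≤ p + ℓ₁ + 1
      · -- no bad point at all
        exfalso; split_ifs at hn₀B <;> omega
      · by_cases hc2 : ℓ₁ + g₁ + v + ℓ₂ = p + ℓ₁ + 2
        · by_cases hg1 : g₁ = 1
          · exfalso; split_ifs at hn₀B <;> omega
          · exact Or.inr (Or.inr (Or.inr (Or.inr (Or.inl ⟨by omega, by omega, by omega, by omega⟩))))
        · by_cases hc3 : p + ℓ₁ + 1 ≤ ℓ₁ + g₁ + v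
          · -- c ≥ ℓ₁ + 1
            by_cases hg1 : g₁ = 1
            · exfalso; omega
            · by_cases hc4 : ℓ₁ + g₁ + v + 1 = p + ℓ₁ + g₁
              · exact Or.inr (Or.inl ⟨by omega, by omega⟩)
              · by_cases hl2 : ℓ₂ = 1
                · exfalso; omega
                · refine two (ℓ₁ + g₁) (ℓ₁ + g₁ + 1) (by omega) (by unfold InT; omega) (by unfold InT; omega)
                    ?_ ?_ <;>
                    · simp only [Bad, InU, wrap]; split_ifs <;> omega
          · -- c ≤ ℓ₁: positions ℓ₁+1, ℓ₁+2 are hit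
            by_cases hg1 : 3 ≤ g₁
            · refine two (ℓ₁ + 1 + p - v) (ℓ₁ + 2 + p - v) (by omega) (by unfold InT; omega)
                (by unfold InT; omega) ?_ ?_ <;>
                · simp only [Bad, InU, wrap]; split_ifs <;> omega
            · by_cases hg1' : g₁ = 2
              · exfalso; omega
              · exfalso; split_ifs at hn₀B <;> omega

/-- Region 3b: `v` in the second block of `U`, the first run overshoots. [folklore] -/
theorem fam_R3b (H : Hyp p ℓ₁ g₁ ℓ₂ g₂ v) (hR2 : ℓ₁ + g₁ ≤ v) (hR3 : v ≤ ℓ₁ + g₁ + ℓ₂)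
    (hfit : ℓ₁ + g₁ + ℓ₂ + 2 ≤ v + ℓ₁) : Fam p ℓ₁ g₁ ℓ₂ g₂ v := by
  obtain ⟨hℓ₁, hℓ₂, hg₁, hg₂, hp, hL, hg, hv2, hvp, hAMO, -⟩ := H
  have two : ∀ n n', n ≠ n' → InT ℓ₁ g₁ ℓ₂ n → InT ℓ₁ g₁ ℓ₂ n' → Bad p ℓ₁ g₁ ℓ₂ v n → Bad p ℓ₁ g₁ ℓ₂ v n' →
      Fam p ℓ₁ g₁ ℓ₂ g₂ v := fun n n' hne h1 h2 h3 h4 => absurd (hAMO n n' h1 h2 h3 h4) hne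
  by_cases hg2 : 2 ≤ g₂
  · by_cases hA : 3 ≤ g₂ ∧ ℓ₁ + g₁ + ℓ₂ + 3 ≤ v + ℓ₁
    · refine two (ℓ₁ + g₁ + ℓ₂ + 1 - v) (ℓ₁ + g₁ + ℓ₂ + 2 - v) (by omega) (by unfold InT; omega)
        (by unfold InT; omega) ?_ ?_ <;>
        · simp only [Bad, InU, wrap]; split_ifs <;> omega
    · by_cases hB : v + ℓ₁ = ℓ₁ + g₁ + ℓ₂ + 2
      · by_cases hAv : ℓ₁ + g₁ + v + 1 ≤ p
        · refine two (ℓ₁ + g₁ + ℓ₂ + 1 - v) (ℓ₁ + g₁) (by omega) (by unfold InT; omega) (by unfold InT; omega)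
            ?_ ?_ <;>
            · simp only [Bad, InU, wrap]; split_ifs <;> omega
        · by_cases hc : ℓ₁ + g₁ + v + ℓ₂ ≤ p + ℓ₁ + 1
          · exact Or.inr (Or.inr (Or.inr (Or.inr (Or.inr ⟨by omega, by omega, by omega, by omega, by omega⟩))))
          · by_cases hg1 : g₁ = 1
            · exfalso; omega
            · by_cases hc' : ℓ₁ + g₁ + v ≤ p + ℓ₁ + 1
              · refine two (ℓ₁ + g₁ + ℓ₂ + 1 - v) (ℓ₁ + 1 + p - v) (by omega) (by unfold InT; omega)
                  (by unfold InT; omega) ?_ ?_ <;>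
                  · simp only [Bad, InU, wrap]; split_ifs <;> omega
              · refine two (ℓ₁ + g₁ + ℓ₂ + 1 - v) (ℓ₁ + g₁) (by omega) (by unfold InT; omega)
                  (by unfold InT; omega) ?_ ?_ <;>
                  · simp only [Bad, InU, wrap]; split_ifs <;> omega
      · -- g₂ = 2 and the overshoot is at least 2
        by_cases hc' : ℓ₁ + g₁ + v ≤ p + ℓ₁
        · refine two (p - 1 - v) (ℓ₁ + 1 + p - v) (by omega) (by unfold InT; omega) (by unfold InT; omega)
            ?_ ?_ <;>
            · simp only [Bad, InU, wrap]; split_ifs <;> omega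
        · refine two (p - 1 - v) (ℓ₁ + g₁) (by omega) (by unfold InT; omega) (by unfold InT; omega) ?_ ?_ <;>
            · simp only [Bad, InU, wrap]; split_ifs <;> omega
  · -- g₂ = 1
    by_cases hAv : ℓ₁ + g₁ + v + 1 ≤ p
    · refine two (ℓ₁ + 1 + p - v) (ℓ₁ + 2 + p - v) (by omega) (by unfold InT; omega) (by unfold InT; omega)
        ?_ ?_ <;>
        · simp only [Bad, InU, wrap]; split_ifs <;> omega
    · by_cases hc4 : v + 1 = p
      · exact Or.inr (Or.inl ⟨by omega, by omega⟩)
      · by_cases hl2 : ℓ₂ = 1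
        · exact Or.inr (Or.inl ⟨by omega, by omega⟩)
        · by_cases hc3 : p + ℓ₁ + 1 ≤ ℓ₁ + g₁ + v
          · refine two (ℓ₁ + g₁) (ℓ₁ + g₁ + 1) (by omega) (by unfold InT; omega) (by unfold InT; omega)
              ?_ ?_ <;>
              · simp only [Bad, InU, wrap]; split_ifs <;> omega
          · refine two (ℓ₁ + 1 + p - v) (ℓ₁ + 2 + p - v) (by omega) (by unfold InT; omega)
              (by unfold InT; omega) ?_ ?_ <;>
              · simp only [Bad, InU, wrap]; split_ifs <;> omega

/-- Region 4: `v` in the second gap. [folklore] -/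
theorem fam_R4 (H : Hyp p ℓ₁ g₁ ℓ₂ g₂ v) (hR3 : ℓ₁ + g₁ + ℓ₂ < v) : Fam p ℓ₁ g₁ ℓ₂ g₂ v := by
  obtain ⟨hℓ₁, hℓ₂, hg₁, hg₂, hp, hL, hg, hv2, hvp, hAMO, -⟩ := H
  have two : ∀ n n', n ≠ n' → InT ℓ₁ g₁ ℓ₂ n → InT ℓ₁ g₁ ℓ₂ n' → Bad p ℓ₁ g₁ ℓ₂ v n → Bad p ℓ₁ g₁ ℓ₂ v n' →
      Fam p ℓ₁ g₁ ℓ₂ g₂ v := fun n n' hne h1 h2 h3 h4 => absurd (hAMO n n' h1 h2 h3 h4) hne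
  by_cases hl1 : 2 ≤ ℓ₁
  · by_cases hv : v + 2 ≤ p
    · refine two 0 1 (by omega) (by unfold InT; omega) (by unfold InT; omega) ?_ ?_ <;>
        · simp only [Bad, InU, wrap]; split_ifs <;> omega
    · by_cases hg1 : g₁ = 1
      · exact Or.inl ⟨by omega, by omega⟩
      · refine two 0 (ℓ₁ + g₁) (by omega) (by unfold InT; omega) (by unfold InT; omega) ?_ ?_ <;>
          · simp only [Bad, InU, wrap]; split_ifs <;> omega
  · by_cases hAv : ℓ₁ + g₁ + v + 1 ≤ p
    · refine two 0 (ℓ₁ + g₁) (by omega) (by unfold InT; omega) (by unfold InT; omega) ?_ ?_ <;>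
        · simp only [Bad, InU, wrap]; split_ifs <;> omega
    · by_cases hg1 : g₁ = 1
      · exact Or.inl ⟨by omega, by omega⟩
      · by_cases hc : p + 2 ≤ ℓ₁ + g₁ + v
        · refine two 0 (ℓ₁ + g₁) (by omega) (by unfold InT; omega) (by unfold InT; omega) ?_ ?_ <;>
            · simp only [Bad, InU, wrap]; split_ifs <;> omega
        · refine two 0 (2 + p - v) (by omega) (by unfold InT; omega) (by unfold InT; omega) ?_ ?_ <;>
            · simp only [Bad, InU, wrap]; split_ifs <;> omega

/-- **The two-run shift lemma.**  Two maximal runs, `ℓ₁+ℓ₂ ≥ 4`, gaps summing to `≥ 7`, a shift `2 ≤ v < p` with EXACTLY ONE bad point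
⇒ one of the twelve families `Fam`.  Proof: the case tree `fam_R1` … `fam_R4` on where `v` falls; every dead branch exhibits two distinct bad
points or none. [folklore] -/
theorem two_run_families (H : Hyp p ℓ₁ g₁ ℓ₂ g₂ v) : Fam p ℓ₁ g₁ ℓ₂ g₂ v := by
  by_cases hR1 : v ≤ ℓ₁
  · exact fam_R1 H hR1
  by_cases hR2 : v < ℓ₁ + g₁
  · exact fam_R2 H (by omega) hR2
  by_cases hR3 : v ≤ ℓ₁ + g₁ + ℓ₂
  · by_cases hfit : v + ℓ₁ ≤ ℓ₁ + g₁ + ℓ₂ + 1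
    · exact fam_R3a H (by omega) hR3 hfit
    · exact fam_R3b H (by omega) hR3 (by omega)
  · exact fam_R4 H (by omega)

/-- **Shape of the families** (odd `p`): either a gap has size `1` and `v ∈ {2, 3, p−2, p−1}` (difference `1`), or `2v ∈ {p−1, p+1, p+3}`
and, with `A = ℓ₁+g₁` and `L = ℓ₁+ℓ₂`, the index bounds that place both runs inside one progression of `L+1` terms of difference `(p+1)/2`:
`2A ≥ p`, `2ℓ₁ ≤ L+2`, `2A − p + 2ℓ₂ ≤ L+2`, or `2A < p`, `p − 2A + 2ℓ₁ ≤ L+2`, `2ℓ₂ ≤ L+2`. [folklore] -/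
theorem two_run_shape (H : Hyp p ℓ₁ g₁ ℓ₂ g₂ v) (hodd : p % 2 = 1) :
    ((g₁ = 1 ∨ g₂ = 1) ∧ (v = 2 ∨ v = 3 ∨ v + 2 = p ∨ v + 1 = p)) ∨
    ((2 * v + 1 = p ∨ 2 * v = p + 1 ∨ 2 * v = p + 3) ∧
      ((p ≤ 2 * (ℓ₁ + g₁) ∧ 2 * ℓ₁ ≤ ℓ₁ + ℓ₂ + 2 ∧ 2 * (ℓ₁ + g₁) + 2 * ℓ₂ ≤ p + ℓ₁ + ℓ₂ + 2) ∨
       (2 * (ℓ₁ + g₁) < p ∧ p + 2 * ℓ₁ ≤ 2 * (ℓ₁ + g₁) + ℓ₁ + ℓ₂ + 2 ∧ 2 * ℓ₂ ≤ ℓ₁ + ℓ₂ + 2))) := by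
  have hF := two_run_families H
  obtain ⟨hℓ₁, hℓ₂, hg₁, hg₂, hp, hL, hg, hv2, hvp, -, -⟩ := H
  unfold Fam at hF
  rcases hF with ⟨hg1, hv⟩ | ⟨hg2', hv⟩ | ⟨h1, h2, h3, h4, h5⟩ | ⟨h1, h2, h3, h4, h5⟩ | ⟨h1, h2, h3, h4⟩ |
      ⟨h1, h2, h3, h4, h5⟩
  · left; exact ⟨Or.inl hg1, by omega⟩
  · left; exact ⟨Or.inr hg2', by omega⟩
  · right
    refine ⟨by omega, Or.inl ⟨by omega, by omega, by omega⟩⟩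
  · right
    refine ⟨by omega, Or.inr ⟨by omega, by omega, by omega⟩⟩
  · right
    refine ⟨by omega, ?_⟩
    by_cases hA : p ≤ 2 * (ℓ₁ + g₁)
    · exact Or.inl ⟨hA, by omega, by omega⟩
    · exact Or.inr ⟨by omega, by omega, by omega⟩
  · right
    refine ⟨by omega, ?_⟩
    by_cases hA : p ≤ 2 * (ℓ₁ + g₁)
    · exact Or.inl ⟨hA, by omega, by omega⟩
    · exact Or.inr ⟨by omega, by omega, by omega⟩

end Main

end Summit.MatrixMultiplication.OmegaCensus.HR3
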